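import Literature.NumberTheory.Automorphic.CentralizerLieAlgebra
import Literature.NumberTheory.Automorphic.RootSpaceLine
import Literature.NumberTheory.Automorphic.LieCentralizerTorusHolds
import Literature.NumberTheory.Automorphic.RankOneDimension
import HarnessLib

/-!
# Springer 8.1.3 (ii), `dim G = dim T + |R|` (`zdim_eq_rank_add_card_roots`): the leaf 5.4.7
# discharged in all characteristics; the discharge in characteristic `0`
(trunk T-AUTOMORPHIC, G25 AutomorphicL; proof file of `BigCellOpen.lean`)

`BigCellOpen.lean` vendors Springer, *Linear Algebraic Groups* (2nd ed.), Cor. 8.1.3 (ii) —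
*"`dim B = r + ½|R|`, `dim G = r + |R|`, where `r = dim T`"*, proof *"Using 8.1.2 one determines
`dim 𝔟` and `dim 𝔤`"* — as the named fact `zdim_eq_rank_add_card_roots G T` (second formula, for
`G ≤ GL n k` connected reductive over an algebraically closed field of **any** characteristic, `T` a
maximal torus with root datum `P`). `RootSpaceDimension.lean` proves it
(`zdim_eq_rank_add_card_roots_of_lie`) from exactly the inputs of the printed proof:

* Springer 8.1.2 (`P = R`, `dim 𝔤_α = 1`) — the tree's named fact `lieWeights_eq_roots`
  (`IsomorphismTheoremUniqueLie.lean`);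
* `𝔤^T ⊆ L(T)` — Springer 5.4.7 (`L(Z_G(T)) = 𝔷_𝔤(T)`) with 7.6.4 (ii) (`Z_G(T) = T`, the tree's
  named fact `centralizer_eq_of_isMaximalTorusIn`, `RootSubgroupStructure.lean`).

This file records:

1. **`lieWeightSpace_one_le_lieAlgebraGL_of_centralizer_eq`** — with 5.4.7 now proved in every
   characteristic (`IsTorusSubgroup.lieWeightSpace_one_le_lieAlgebraGL_centralizer`,
   `CentralizerLieAlgebra.lean`), the named fact `lieWeightSpace_one_le_lieAlgebraGL G T`
   (`𝔤^T ⊆ L(T)`, `RootSpaceDimension.lean`) follows from 7.6.4 (ii) alone;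
2. **`zdim_eq_rank_add_card_roots_of_facts`** — hence 8.1.3 (ii) follows, in every characteristic,
   from the two named facts 8.1.2 (`lieWeights_eq_roots`) and 7.6.4 (ii)
   (`centralizer_eq_of_isMaximalTorusIn`), both still undischarged in positive characteristic;
3. **`zdim_eq_rank_add_card_roots_of_charZero`** — in characteristic `0` the fact holds outright
   (`zdim_eq_rank_add_card_roots_of_lieWeightSpace_one_le`, `RootSpaceLine.lean`, with
   `lieWeightSpace_one_le_lieAlgebraGL_holds`, `LieCentralizerTorusHolds.lean`).

4. **`zdim_eq_rank_add_card_roots_of_lieWeights_eq_roots`**,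
   **`zdim_eq_rank_add_card_roots_of_lieWeights_subset_roots`** — with 7.6.4 (ii) now a theorem in
   every characteristic (`centralizer_eq_of_isMaximalTorusIn_holds`, `CentralizerTorusConnected.lean`)
   and the second clause `dim 𝔤_α = 1` of 8.1.2 proved (`RankOneDimension.lean`), 8.1.3 (ii) follows
   from 8.1.2 alone, and indeed from its first clause `P ⊆ R` alone; composed with
   `lieWeights_eq_roots_of_singularCentralizer_eq` (`RankOneWeights.lean`) it also follows from the
   last sentence of the printed proof of 8.1.2 — *"If `β ∈ P` then `G_β` … must be a `G_α` with
   `α ∈ R`"*, the hypothesis `∀ β ∈ P, ∃ α ∈ R, (Ker β)° = (Ker α)°` of `RankOneGeneration.lean`.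

No new named fact is introduced and no statement is changed; in positive characteristic the closed
discharge `zdim_eq_rank_add_card_roots_holds` awaits exactly the first clause `P ⊆ R` of 8.1.2
(`lieWeights_eq_roots`), i.e. root homomorphisms for the non-zero weights (Springer 7.3.3 (i) via
7.2.3 and 3.4.9 inside the groups `G_β`).

## References

* T. A. Springer, *Linear Algebraic Groups*, 2nd ed., Progress in Mathematics 9, Birkhäuser
  (1998) [SpringerLAG1998]: Cor. 5.4.7, Cor. 7.6.4 (ii), 7.3.2, Cor. 8.1.2 (statement and proof),
  Cor. 8.1.3 (ii) (p. 145).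
-/

noncomputable section

open scoped MatrixGroups IsMulCommutative

namespace Literature.NumberTheory.Automorphic

variable {k : Type*} [Field k] {n : Type*} [Fintype n] [DecidableEq n]
variable {ι X Y : Type*} [AddCommGroup X] [AddCommGroup Y]
variable {G T : Subgroup (GL n k)}

/-- **`𝔤^T ⊆ L(T)` from 7.6.4 (ii) alone, all characteristics**: the named fact
`lieWeightSpace_one_le_lieAlgebraGL G T` (Springer 5.4.7 with 7.6.4 (ii)) follows from
`centralizer_eq_of_isMaximalTorusIn` (`Z_G(T) = T`), the inclusion `𝔤^T ⊆ L(Z_G(T))` being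
Springer 5.4.7 (`IsTorusSubgroup.lieWeightSpace_one_le_lieAlgebraGL_centralizer`).
[cite: SpringerLAG1998, Cor. 5.4.7 and Cor. 7.6.4 (ii)] -/
theorem lieWeightSpace_one_le_lieAlgebraGL_of_centralizer_eq
    (h764 : centralizer_eq_of_isMaximalTorusIn (k := k) (n := n)) :
    lieWeightSpace_one_le_lieAlgebraGL G T :=
  lieWeightSpace_one_le_lieAlgebraGL_of_centralizer
    (fun hG hT => hT.2.1.lieWeightSpace_one_le_lieAlgebraGL_centralizer hG.1 hT.1) h764

variable [IsMulCommutative ↥T]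

/-- **Springer 8.1.3 (ii) from 8.1.2 and 7.6.4 (ii), all characteristics.** The named fact
`zdim_eq_rank_add_card_roots G T` (`dim G = dim T + |R|`) follows from Springer 8.1.2
(`lieWeights_eq_roots`: `P = R` and `dim 𝔤_α = 1`) and 7.6.4 (ii)
(`centralizer_eq_of_isMaximalTorusIn`: `Z_G(T) = T`): `Lie(G) = 𝔤^T ⊕ ⨁_{α ∈ P} 𝔤_α` with
`𝔤^T = L(Z_G(T)) = L(T)` (5.4.7, proved) — Springer's "using 8.1.2 one determines `dim 𝔤`"
(`zdim_eq_rank_add_card_roots_of_lie`).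
[cite: SpringerLAG1998, Cor. 8.1.3 (ii) with Cor. 8.1.2, Cor. 5.4.7, Cor. 7.6.4 (ii)] -/
theorem zdim_eq_rank_add_card_roots_of_facts (h812 : lieWeights_eq_roots (G := G) (T := T))
    (h764 : centralizer_eq_of_isMaximalTorusIn (k := k) (n := n)) :
    zdim_eq_rank_add_card_roots (ι := ι) (X := X) (Y := Y) G T :=
  zdim_eq_rank_add_card_roots_of_lie (fun hG hT => (h812 hG hT).1.le)
    (fun hG hT α hα => ((h812 hG hT).2 α hα).le)
    (lieWeightSpace_one_le_lieAlgebraGL_of_centralizer_eq h764)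

/-- **Springer 8.1.3 (ii) in characteristic `0`**: over algebraically closed fields of
characteristic `0` the named fact `zdim_eq_rank_add_card_roots G T` holds unconditionally
(`zdim_eq_rank_add_card_roots_of_lieWeightSpace_one_le` with
`lieWeightSpace_one_le_lieAlgebraGL_holds`). [cite: SpringerLAG1998, Cor. 8.1.3 (ii)] -/
theorem zdim_eq_rank_add_card_roots_of_charZero [CharZero k] :
    zdim_eq_rank_add_card_roots (ι := ι) (X := X) (Y := Y) G T :=
  zdim_eq_rank_add_card_roots_of_lieWeightSpace_one_le (lieWeightSpace_one_le_lieAlgebraGL_holds G T)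

/-- **Springer 8.1.3 (ii) from 8.1.2 alone, all characteristics**: with 7.6.4 (ii) a theorem
(`centralizer_eq_of_isMaximalTorusIn_holds`, `CentralizerTorusConnected.lean`), the named fact
`zdim_eq_rank_add_card_roots G T` follows from the named fact `lieWeights_eq_roots` (8.1.2) for
`(G, T)` by `zdim_eq_rank_add_card_roots_of_facts`. [cite: SpringerLAG1998, Cor. 8.1.3 (ii) with Cor. 8.1.2] -/
theorem zdim_eq_rank_add_card_roots_of_lieWeights_eq_roots
    (h812 : lieWeights_eq_roots (G := G) (T := T)) :
    zdim_eq_rank_add_card_roots (ι := ι) (X := X) (Y := Y) G T :=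
  zdim_eq_rank_add_card_roots_of_facts h812 centralizer_eq_of_isMaximalTorusIn_holds

/-- **Springer 8.1.3 (ii) from the first clause `P ⊆ R` of 8.1.2, all characteristics**: the
second clause `dim 𝔤_α = 1` being a theorem (`lieWeights_eq_roots_of_subset`,
`RankOneDimension.lean`: 7.2.3/7.3.2 inside `G_α`), `dim G = dim T + |R|` follows from the
inclusion of the non-zero weights of `T` in `𝔤` in the roots. (Conversely the formula forces
`P ⊆ R`, since `dim 𝔤 = dim 𝔤^T + ∑_{β ∈ P} dim 𝔤_β` with `𝔤^T = L(T)`; so this hypothesis is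
exactly what 8.1.3 (ii) still needs in positive characteristic.)
[cite: SpringerLAG1998, Cor. 8.1.3 (ii) with Cor. 8.1.2] -/
theorem zdim_eq_rank_add_card_roots_of_lieWeights_subset_roots
    (hPR : ∀ [IsAlgClosed k], IsConnectedReductive G → IsMaximalTorusIn T G →
      lieWeights G T ⊆ roots G T) :
    zdim_eq_rank_add_card_roots (ι := ι) (X := X) (Y := Y) G T :=
  zdim_eq_rank_add_card_roots_of_lieWeights_eq_roots (lieWeights_eq_roots_of_subset hPR)

end Literature.NumberTheory.Automorphic

end
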